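/- Free-seat work of WIDTH SEAT 2/3 `ym-line-cbag-p1-w2` (prover-ym-line-cbag-p1-w2-g16-0), route
`EguchiKawaiDirectionLadder` (ideator ym-idea-2, LINE 8), crux `DirectionIncrement` (stmt-QuantumFields-27725):
the Fubini step B2 of the planner's BC3 skeleton (`FubiniIncrement : SingleLinkRigidity → DirectionIncrement`). -/
import Summits.QuantumFields.YangMills.Theses.EguchiKawaiDirectionLadder

/-!
# Route `EguchiKawaiDirectionLadder`, crux `DirectionIncrement` (K_B): the Fubini step
`SingleLinkRigidity → DirectionIncrement` — PROVED

The BC3 birth skeleton of the crux (`HOME/l8/bc/DirectionIncrement_birth.lean` of ideator ym-idea-2) composes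
`DirectionIncrement` from two stubs: the load-bearing ONE-matrix rigidity bound `SingleLinkRigidity` (B1) — for a
centre-symmetric `U ∈ U(N)` (`|tr U/N|² ≤ δ < 1/2`) the Haar measure of `{W : S_R(![U, W]) ≤ t}` is at most
`exp(N²(((1 − 2δ)/4)·log t + C))`, uniformly in `N ≥ N₀`, `t > 0` — and the Fubini step `FubiniIncrement` (B2).
This file proves B2 with the hypothesis B1 SPELLED OUT (no new definitions), in the slightly more general form
`ekSymSmallBallBound_succ_of_fibre`: a fibrewise one-matrix bound with ANY exponent `κ` and constant `C_B` turns
`EKSymSmallBallBound d δ e C` into `EKSymSmallBallBound (d + 1) δ (e + κ) (C + C_B)`.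

The argument (all `N ≥ max N₀ N₁`, `t > 0`; `d = d' + 1 ≥ 1`):
* split a `(d+1)`-tuple `U` as `(W, V) = (U_last, U|_{Fin d})` — the measurable equivalence
  `MeasurableEquiv.piFinSuccAbove _ (Fin.last d)` carries `Haar^{⊗(d+1)}` to `Haar ⊗ Haar^{⊗d}`
  (`measurePreserving_piFinSuccAbove`);
* `Sym_δ^{(d+1)} ⊆ {V ∈ Sym_δ^{(d)}}` and `|tr V₀/N|² ≤ δ`; and the reduced action only GROWS with the number of
  directions, keeping at least the old plaquettes and the new pair `(0, last)`:
  `S_R^{(d+1)}(U) ≥ S_R^{(d)}(V) + S_R^{(2)}(![V₀, W])` (`ekAction_restrict_add_pair_le`; every summand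
  `(1 − Re tr P/N)/2 = ‖[U_μ,U_ν]‖_F²/(4N)` of Makeenko's (14.38) is non-negative);
* hence `Sym^{(d+1)} ∩ {S_R ≤ t} ⊆ {(W, V) : V ∈ Sym^{(d)} ∩ {S_R ≤ t}, S_R(![V₀, W]) ≤ t}`, a closed set whose
  product measure is `∫ 1_{S}(V) · Haar{W : S_R(![V₀,W]) ≤ t} dV ≤ e^{N²(κ log t + C_B)} · Haar^{⊗d}(S)
  ≤ e^{N²((e + κ) log t + C + C_B)}` (`Measure.prod_apply_symm`, `lintegral_indicator_const`).

With `κ = (1 − 2δ)/4` this is `directionIncrement_of_singleLinkRigidity : SingleLinkRigidity → DirectionIncrement`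
(the skeleton's `stub_fubiniIncrement`, hypothesis verbatim with `pairConfig U W` unfolded to `![U, W]`).

HONEST FRAMING.  Measure-theoretic plumbing only; the research content of the crux is the one-matrix bound B1
(Szarek-type `N`-uniform metric entropy of partial flag manifolds), which is NOT proved here.  The route bears on the
barrier-ledger fact `EguchiKawaiBreakdown`; nothing here bears on the Yang–Mills mass gap.
-/

set_option autoImplicit false

noncomputable section

open MeasureTheory Set
open scoped ENNReal
open Literature.Barriers.QuantumFields

namespace Summit.QuantumFields.YangMills.Theorems.EguchiKawaiDirectionLadder

variable {d N : ℕ}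

/-! ### The reduced action grows with the number of directions -/

/-- Every summand of Makeenko's reduced action (14.38) is non-negative:
`0 ≤ (1 − Re tr(U_ν†U_μ†U_νU_μ)/N)/2` (it equals `‖[U_μ,U_ν]‖_F²/(4N)` for `N ≥ 1`, and `1/2` for `N = 0`). -/
theorem ekAction_summand_nonneg (U : EKConfig d N) (μ ν : Fin d) :
    0 ≤ (if μ = ν then (0 : ℝ) else (1 - (ekPlaqTrace U μ ν).re / N) / 2) := by
  split_ifs
  · exact le_rfl
  · have h := ekCommNormSq_eq U μ ν
    have h0 := ekCommNormSq_nonneg U μ ν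
    have hre : (ekPlaqTrace U μ ν).re ≤ N := by linarith
    have hdiv : (ekPlaqTrace U μ ν).re / N ≤ 1 := by
      rcases Nat.eq_zero_or_pos N with hN | hN
      · subst hN; simp
      · exact div_le_one_of_le₀ hre (by positivity)
    linarith

/-- The reduced action of the two-link configuration `![A, B]` is the sum of its two (equal) plaquette terms. -/
theorem ekAction_pair (A B : UN N) :
    ekAction (![A, B] : EKConfig 2 N) =
      (1 - (ekPlaqTrace (![A, B] : EKConfig 2 N) 0 1).re / N) / 2 +
        (1 - (ekPlaqTrace (![A, B] : EKConfig 2 N) 1 0).re / N) / 2 := by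
  simp [ekAction, Fin.sum_univ_two]

/-- The new pair `(U₀, U_last)` of a `(d+2)`-tuple has the plaquette traces of the tuple at `(0, last)`. -/
theorem ekPlaqTrace_pair_zero_one (U : EKConfig (d + 2) N) :
    ekPlaqTrace (![U 0, U (Fin.last (d + 1))] : EKConfig 2 N) 0 1 = ekPlaqTrace U 0 (Fin.last (d + 1)) := by
  simp [ekPlaqTrace]

/-- Companion of `ekPlaqTrace_pair_zero_one` for the transposed plaquette `(last, 0)`. -/
theorem ekPlaqTrace_pair_one_zero (U : EKConfig (d + 2) N) :
    ekPlaqTrace (![U 0, U (Fin.last (d + 1))] : EKConfig 2 N) 1 0 = ekPlaqTrace U (Fin.last (d + 1)) 0 := by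
  simp [ekPlaqTrace]

/-- **Action splitting** (`S_R` grows with the number of reduced directions): for a `(d+2)`-tuple `U`,
`S_R^{(d+1)}(U|_{Fin (d+1)}) + S_R^{(2)}(![U₀, U_last]) ≤ S_R^{(d+2)}(U)` — drop the (non-negative) commutator terms
`[U_μ, U_last]`, `1 ≤ μ ≤ d`. -/
theorem ekAction_restrict_add_pair_le (U : EKConfig (d + 2) N) :
    ekAction (fun j : Fin (d + 1) => U (Fin.castSucc j)) +
        ekAction (![U 0, U (Fin.last (d + 1))] : EKConfig 2 N) ≤ ekAction U := by
  -- the summands of the big action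
  set c : Fin (d + 2) → Fin (d + 2) → ℝ :=
    fun μ ν => if μ = ν then (0 : ℝ) else (1 - (ekPlaqTrace U μ ν).re / N) / 2 with hc
  have hc0 : ∀ μ ν, 0 ≤ c μ ν := fun μ ν => ekAction_summand_nonneg U μ ν
  have hU : ekAction U = ∑ μ, ∑ ν, c μ ν := rfl
  -- peel off the last index in both sums
  have hsplit : ∑ μ, ∑ ν, c μ ν =
      (∑ μ : Fin (d + 1), ∑ ν : Fin (d + 1), c (Fin.castSucc μ) (Fin.castSucc ν)) +
        (∑ μ : Fin (d + 1), c (Fin.castSucc μ) (Fin.last (d + 1))) +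
        (∑ ν : Fin (d + 1), c (Fin.last (d + 1)) (Fin.castSucc ν)) +
        c (Fin.last (d + 1)) (Fin.last (d + 1)) := by
    rw [Fin.sum_univ_castSucc]
    simp only [Fin.sum_univ_castSucc (f := fun ν => c _ ν)]
    rw [Finset.sum_add_distrib]
    ring
  -- the restricted action is the first block
  have hV : ekAction (fun j : Fin (d + 1) => U (Fin.castSucc j)) =
      ∑ μ : Fin (d + 1), ∑ ν : Fin (d + 1), c (Fin.castSucc μ) (Fin.castSucc ν) := by
    unfold ekAction
    refine Finset.sum_congr rfl fun μ _ => Finset.sum_congr rfl fun ν _ => ?_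
    simp only [hc, Fin.castSucc_inj]
    rfl
  -- the pair action is `c 0 last + c last 0`
  have h0l : (0 : Fin (d + 2)) ≠ Fin.last (d + 1) := by
    simp [Fin.ext_iff]
  have hP : ekAction (![U 0, U (Fin.last (d + 1))] : EKConfig 2 N) =
      c 0 (Fin.last (d + 1)) + c (Fin.last (d + 1)) 0 := by
    rw [ekAction_pair, ekPlaqTrace_pair_zero_one, ekPlaqTrace_pair_one_zero]
    simp only [hc, if_neg h0l, if_neg h0l.symm]
  -- single terms are bounded by the cross sums
  have h1 : c 0 (Fin.last (d + 1)) ≤ ∑ μ : Fin (d + 1), c (Fin.castSucc μ) (Fin.last (d + 1)) := by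
    have := Finset.single_le_sum (f := fun μ : Fin (d + 1) => c (Fin.castSucc μ) (Fin.last (d + 1)))
      (fun μ _ => hc0 _ _) (Finset.mem_univ (0 : Fin (d + 1)))
    simpa using this
  have h2 : c (Fin.last (d + 1)) 0 ≤ ∑ ν : Fin (d + 1), c (Fin.last (d + 1)) (Fin.castSucc ν) := by
    have := Finset.single_le_sum (f := fun ν : Fin (d + 1) => c (Fin.last (d + 1)) (Fin.castSucc ν))
      (fun ν _ => hc0 _ _) (Finset.mem_univ (0 : Fin (d + 1)))
    simpa using this
  have h3 : 0 ≤ c (Fin.last (d + 1)) (Fin.last (d + 1)) := hc0 _ _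
  rw [hU, hsplit, hV, hP]
  linarith

/-! ### The centre-symmetric region under restriction -/

/-- Restricting a centre-symmetric tuple gives a centre-symmetric tuple. -/
theorem restrict_mem_ekSymRegion {δ : ℝ} {U : EKConfig (d + 2) N} (hU : U ∈ ekSymRegion (d + 2) N δ) :
    (fun j : Fin (d + 1) => U (Fin.castSucc j)) ∈ ekSymRegion (d + 1) N δ :=
  fun μ => hU (Fin.castSucc μ)

/-- The first link of a centre-symmetric tuple is centre-symmetric: `|tr U₀/N|² ≤ δ`. -/
theorem norm_trace_div_sq_le_of_mem_ekSymRegion {e : ℕ} [NeZero e] {δ : ℝ} {V : EKConfig e N}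
    (hV : V ∈ ekSymRegion e N δ) :
    ‖Matrix.trace ((V 0 : UN N) : Matrix (Fin N) (Fin N) ℂ) / (N : ℂ)‖ ^ 2 ≤ δ :=
  hV 0

/-! ### Fubini over the last direction -/

/-- Continuity of `(W, V) ↦ ![V₀, W]`. -/
theorem continuous_pair_of_prod (e : ℕ) [NeZero e] :
    Continuous fun p : UN N × EKConfig e N => (![p.2 0, p.1] : EKConfig 2 N) := by
  refine continuous_pi fun i => ?_
  fin_cases i <;> simp <;> fun_prop

/-- **One more direction, fibrewise** (the Fubini step in general form): if for all `N ≥ N₁`, every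
centre-symmetric `U ∈ U(N)` (`|tr U/N|² ≤ δ`) and every `t > 0` the Haar measure of `{W : S_R(![U, W]) ≤ t}` is at
most `exp(N²(κ log t + C_B))`, then `EKSymSmallBallBound d δ e C` for `d ≥ 1` implies
`EKSymSmallBallBound (d + 1) δ (e + κ) (C + C_B)`. -/
theorem ekSymSmallBallBound_succ_of_fibre {δ e C κ C_B : ℝ} {N₁ : ℕ}
    (hfibre : ∀ N : ℕ, N₁ ≤ N → ∀ U : UN N,
      ‖Matrix.trace (U : Matrix (Fin N) (Fin N) ℂ) / (N : ℂ)‖ ^ 2 ≤ δ → ∀ t : ℝ, 0 < t →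
        Literature.MathematicalPhysics.QuantumFieldTheory.haarProbability (UN N)
            {W : UN N | ekAction (![U, W] : EKConfig 2 N) ≤ t} ≤
          ENNReal.ofReal (Real.exp ((N : ℝ) ^ 2 * (κ * Real.log t + C_B))))
    (h : EKSymSmallBallBound (d + 1) δ e C) :
    EKSymSmallBallBound (d + 2) δ (e + κ) (C + C_B) := by
  obtain ⟨N₀, hN₀⟩ := h
  refine ⟨max N₀ N₁, fun N hN t ht => ?_⟩
  have hNN₀ : N₀ ≤ N := le_trans (le_max_left _ _) hN
  have hNN₁ : N₁ ≤ N := le_trans (le_max_right _ _) hN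
  -- notation
  set haar := Literature.MathematicalPhysics.QuantumFieldTheory.haarProbability (UN N) with hhaar
  set S : Set (EKConfig (d + 1) N) := ekSymRegion (d + 1) N δ ∩ {V | ekAction V ≤ t} with hS
  set KB : ℝ≥0∞ := ENNReal.ofReal (Real.exp ((N : ℝ) ^ 2 * (κ * Real.log t + C_B))) with hKB
  set B : Set (UN N × EKConfig (d + 1) N) :=
    {p | p.2 ∈ S ∧ ekAction (![p.2 0, p.1] : EKConfig 2 N) ≤ t} with hB
  set Φ := MeasurableEquiv.piFinSuccAbove (fun _ : Fin (d + 2) => UN N) (Fin.last (d + 1)) with hΦ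
  -- measurability
  have hSclosed : IsClosed S := (isClosed_ekSymRegion δ).inter (isClosed_ekAction_le t)
  have hSmeas : MeasurableSet S := hSclosed.measurableSet
  have hBclosed : IsClosed B := by
    have h1 : IsClosed {p : UN N × EKConfig (d + 1) N | p.2 ∈ S} := hSclosed.preimage continuous_snd
    have h2 : IsClosed {p : UN N × EKConfig (d + 1) N | ekAction (![p.2 0, p.1] : EKConfig 2 N) ≤ t} :=
      isClosed_le (continuous_ekAction.comp (continuous_pair_of_prod (N := N) (d + 1))) continuous_const
    exact h1.inter h2
  have hBmeas : MeasurableSet B := hBclosed.measurableSet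
  -- the split is measure preserving
  have hΦmp : MeasurePreserving Φ (ekHaar (d + 2) N) (haar.prod (ekHaar (d + 1) N)) := by
    rw [hΦ, hhaar]
    unfold ekHaar
    exact measurePreserving_piFinSuccAbove (fun _ : Fin (d + 2) => _) (Fin.last (d + 1))
  -- the set inclusion
  have hsub : ekSymRegion (d + 2) N δ ∩ {U | ekAction U ≤ t} ⊆ Φ ⁻¹' B := by
    rintro U ⟨hUsym, hUact⟩
    have hUact' : ekAction U ≤ t := hUact
    have hrestr : (fun j : Fin (d + 1) => U ((Fin.last (d + 1)).succAbove j)) =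
        fun j : Fin (d + 1) => U (Fin.castSucc j) := by
      funext j; rw [Fin.succAbove_last]
    have hΦ2 : (Φ U).2 = fun j : Fin (d + 1) => U (Fin.castSucc j) := by
      rw [← hrestr]; rfl
    have hΦ1 : (Φ U).1 = U (Fin.last (d + 1)) := rfl
    have hsplit := ekAction_restrict_add_pair_le U
    have hVnn := ekAction_nonneg (fun j : Fin (d + 1) => U (Fin.castSucc j))
    have hPnn := ekAction_nonneg (![U 0, U (Fin.last (d + 1))] : EKConfig 2 N)
    show Φ U ∈ B
    rw [hB, Set.mem_setOf_eq, hΦ2, hΦ1]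
    refine ⟨⟨restrict_mem_ekSymRegion hUsym, ?_⟩, ?_⟩
    · show ekAction (fun j : Fin (d + 1) => U (Fin.castSucc j)) ≤ t
      linarith
    · have h0 : (fun j : Fin (d + 1) => U (Fin.castSucc j)) 0 = U 0 := by
        simp
      rw [h0]
      linarith
  -- fibrewise bound
  have hfib : ∀ V : EKConfig (d + 1) N,
      haar ((fun W : UN N => (W, V)) ⁻¹' B) ≤ S.indicator (fun _ => KB) V := by
    intro V
    by_cases hV : V ∈ S
    · rw [Set.indicator_of_mem hV]
      have hset : (fun W : UN N => (W, V)) ⁻¹' B = {W : UN N | ekAction (![V 0, W] : EKConfig 2 N) ≤ t} := by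
        ext W; simp [hB, hV]
      rw [hset]
      exact hfibre N hNN₁ (V 0) (norm_trace_div_sq_le_of_mem_ekSymRegion hV.1) t ht
    · have hset : (fun W : UN N => (W, V)) ⁻¹' B = ∅ := by
        ext W; simp [hB, hV]
      rw [hset, measure_empty]
      exact bot_le
  -- assemble
  calc ekHaar (d + 2) N (ekSymRegion (d + 2) N δ ∩ {U | ekAction U ≤ t})
      ≤ ekHaar (d + 2) N (Φ ⁻¹' B) := measure_mono hsub
    _ = (haar.prod (ekHaar (d + 1) N)) B := hΦmp.measure_preimage hBmeas.nullMeasurableSet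
    _ = ∫⁻ V, haar ((fun W : UN N => (W, V)) ⁻¹' B) ∂(ekHaar (d + 1) N) := Measure.prod_apply_symm hBmeas
    _ ≤ ∫⁻ V, S.indicator (fun _ => KB) V ∂(ekHaar (d + 1) N) := lintegral_mono hfib
    _ = KB * ekHaar (d + 1) N S := lintegral_indicator_const hSmeas KB
    _ ≤ KB * ENNReal.ofReal (Real.exp ((N : ℝ) ^ 2 * (e * Real.log t + C))) := by
        gcongr
        exact hN₀ N hNN₀ t ht
    _ = ENNReal.ofReal (Real.exp ((N : ℝ) ^ 2 * ((e + κ) * Real.log t + (C + C_B)))) := by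
        rw [hKB, ← ENNReal.ofReal_mul (Real.exp_pos _).le, ← Real.exp_add]
        congr 2
        ring

/-- **Stub B2 of the `DirectionIncrement` skeleton (`FubiniIncrement : SingleLinkRigidity → DirectionIncrement`),
with the hypothesis `SingleLinkRigidity` spelled out** (`pairConfig U W` unfolded to `![U, W]`): the one-matrix
rigidity bound with exponent `(1 − 2δ)/4`, uniform over centre-symmetric `U` and `N ≥ N₀`, implies the route's crux
`DirectionIncrement`.  The bound B1 itself is NOT proved here. -/
theorem directionIncrement_of_singleLinkRigidity
    (hSLR : ∀ δ : ℝ, 0 < δ → δ < 1 / 2 → ∃ C : ℝ, 0 ≤ C ∧ ∃ N₀ : ℕ, ∀ N : ℕ, N₀ ≤ N → ∀ U : UN N,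
      ‖Matrix.trace (U : Matrix (Fin N) (Fin N) ℂ) / (N : ℂ)‖ ^ 2 ≤ δ → ∀ t : ℝ, 0 < t →
        Literature.MathematicalPhysics.QuantumFieldTheory.haarProbability (UN N)
            {W : UN N | ekAction (![U, W] : EKConfig 2 N) ≤ t} ≤
          ENNReal.ofReal (Real.exp ((N : ℝ) ^ 2 * ((1 - 2 * δ) / 4 * Real.log t + C)))) :
    Summit.QuantumFields.YangMills.Theses.EguchiKawaiDirectionLadder.DirectionIncrement := by
  unfold Summit.QuantumFields.YangMills.Theses.EguchiKawaiDirectionLadder.DirectionIncrement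
  intro d hd δ e C hδ hδ' hSB
  obtain ⟨C_B, -, N₁, hB⟩ := hSLR δ hδ hδ'
  obtain ⟨d', rfl⟩ : ∃ d', d = d' + 1 := Nat.exists_eq_succ_of_ne_zero (by omega)
  exact ⟨C + C_B, ekSymSmallBallBound_succ_of_fibre (κ := (1 - 2 * δ) / 4) hB hSB⟩

end Summit.QuantumFields.YangMills.Theorems.EguchiKawaiDirectionLadder

end
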